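import Literature.NumberTheory.EllipticCurves.FormalGroupLawPadicProofs
import Literature.NumberTheory.EllipticCurves.CanonicalPAdicHeightAdmissibleProofs
import HarnessLib

/-!
# The canonical `p`-adic height: existence of the canonical datum for ONE curve and ONE odd
# prime from the theta identity of its own sigma series (pointwise assembly)

Trunk T-NT-EC (Literature/NumberTheory/EllipticCurves); proofs only, behind the named fact
`WeierstrassCurve.exists_isCanonical` of `CanonicalPAdicHeight.lean` (existence of the canonical
cyclotomic `p`-adic height datum whose quadratic form on admissible points is the sigma formula
`ĥ_p(P) = log_p(den x(P)) - 2 log_p σ_p(z(P))`, Stein–Wuthrich 2013 §4.1 (4.1) = `-2p ×`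
Mazur–Stein–Tate 2006 (1.1)).

After `FormalGroupLawPadicProofs.lean` the tree has
`exists_isCanonical ⟸ mazur_tate_sigma_existsUnique ∧ padicSigma_theta_formal`
(`exists_isCanonical_of_MT_theta`), every arrow being a theorem but both inputs being GLOBAL
named facts (quantified over all globally minimal `W` and all `p ≥ 5` good ordinary), the first
of them an `∃!`. This file re-assembles the same printed argument (MST 2006 §1, §2.6–2.7)
POINTWISE and with the hypotheses it actually consumes, and records two consequences:

* `padicSigmaAt_theta_of_thetaLHS_eq` — for ANY prime `p`, any `ℤ`-integral elliptic `W/ℚ`: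
  if the sigma series `σ_p` of `W ⊗ ℚ_p` (`WeierstrassCurve.padicSigma`, the chosen Mazur–Tate
  pair or the junk value `t`; integral in either case, `norm_coeff_padicSigma_le`) satisfies the
  formal theta identity `thetaLHS σ_p = thetaRHS σ_p` in `ℚ_p⟦u, v⟧`
  (`CanonicalPAdicHeightThetaProofs.lean`), then the theta relation
  `σ(P+Q)σ(P-Q) = (x(Q) - x(P)) σ(P)² σ(Q)²` holds at all rational points `P ≠ ±Q` of the kernel
  of reduction (evaluation at `(z(P), z(Q))`, θ₃ = `formalGroupLaw_padicEval_holds`);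
* `canonicalPAdicHeight_parallelogram_of_thetaLHS_eq` — hence, for `p` ODD and `W` globally
  minimal, the parallelogram law of the sigma formula on generic admissible pairs (Néron's
  denominator law `padicValNat_den_parallelogram_holds`, `log_p` multiplicativity
  `padicLog_mul_holds`, `σ_p ≠ 0` on `E₁`);
* `exists_isCanonical_of_thetaLHS_eq`, `existsUnique_isCanonical_of_thetaLHS_eq` — hence **a
  (unique) canonical `p`-adic height datum `D : PAdicHeightData W p` exists for every globally
  minimal elliptic `W/ℚ` and every ODD prime `p` whose sigma series satisfies the formal theta
  identity** (torsion-freeness of `E₁(ℚ_p)` for `p ≥ 3`, the admissible subgroup, Jordan–von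
  Neumann on a subgroup, admissible multiples `exists_admissible_nsmul_holds` — all theorems of
  the tree). No reduction hypothesis at `p` and no `p ≥ 5` enter this implication: they enter
  only through the EXISTENCE of a Mazur–Tate pair, which is what makes `σ_p` a genuine sigma
  function;
* `exists_isCanonical_of_forall_thetaLHS_eq` — `exists_isCanonical` from the single global
  hypothesis "for `W` globally minimal and `p ≥ 5` good ordinary, `σ_p` satisfies the formal theta
  identity";
* `padicSigma_theta_of_exists_pair`, `exists_isCanonical_of_exists_pair`,
  `existsUnique_isCanonical_of_exists_pair` — in particular `exists_isCanonical` follows from the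
  EXISTENCE half alone of MST 2006 Thm. 1.3 (a Mazur–Tate pair exists for `W ⊗ ℚ_p`; the
  uniqueness clause of `mazur_tate_sigma_existsUnique` is not used anywhere on the route)
  together with `padicSigma_theta_formal`.

So the inputs still missing for `exists_isCanonical` are exactly: (θ₁∃) existence of an integral,
odd, normalised solution of the sigma differential equation for `W ⊗ ℚ_p` (Mazur–Tate 1991,
Thm. 3.1 / MST 2006 Thm. 1.3, existence part — the deep input: integrality encodes the `p`-adic
unit-root value `E₂(E, ω)`), and (θ₂) the formal theta identity for such a solution
(Blakestad–Grant 2023, Prop. 14). Nothing is asserted here; no definition, no new named fact.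

## Sources

* B. Mazur, W. Stein, J. Tate, *Computation of `p`-adic heights and log convergence*, Doc. Math.
  Extra Vol. Coates (2006): Thm. 1.3 (existence and uniqueness of `(σ, c)`), §1 (eq. (1.1),
  "extends uniquely"), §2.6–2.7 ("`h_ρ` is quadratic because of property IV of `σ`").
* B. Mazur, J. Tate, *The `p`-adic sigma function*, Duke Math. J. 62 (1991), Thm. 3.1.
* C. Blakestad, D. Grant, J. Number Theory 249 (2023) (arXiv:1903.02480), Prop. 14, Thm. 15.
* W. Stein, C. Wuthrich, Math. Comp. 82 (2013), §4.1 eq. (4.1).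
* J. H. Silverman, *AEC* 2nd ed. (2009), IV.1–2, VII.2.2 (θ₃); *ATAEC* (1994), VI.4.1, Ex. 6.3.

## Design notes

* Pure proof file. The pointwise statements carry only the hypotheses their proofs use:
  `[W.IsElliptic] [W.IsIntegral ℤ]` and any prime for the theta relation at points;
  `[W.IsGloballyMinimal]` (through the torsion leaf, stated for minimal `W`) and `p ≠ 2` (the
  admissible locus is `E₁ ∩ ⋂ E₀`, and `σ_p ≠ 0` on `E₁`, for odd `p`) for the datum.
* The hypothesis on `σ_p` is the equation `thetaLHS σ_p = thetaRHS σ_p` for the CHOSEN series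
  `(W ⊗ ℚ_p).padicSigma`; under θ₁∃ it is a Mazur–Tate pair (`isMazurTateSigmaPair_padicSigma`)
  and θ₂ applies to it — this is the only place where a Mazur–Tate pair is needed.
-/

noncomputable section

open scoped Classical
open PowerSeries Literature.NumberTheory.EllipticCurves

namespace WeierstrassCurve

/-! ### The theta relation at rational points of `E₁(ℚ_p)` from the formal identity for `σ_p` -/

section Pointwise

variable (W : WeierstrassCurve ℚ) (p : ℕ) [Fact p.Prime]

/-- The sigma series of `W ⊗ ℚ_p` is `p`-integral (Mazur–Tate pair or junk value `t`).
[Mazur–Stein–Tate 2006, Thm. 1.3 (`σ ∈ tℤ_p⟦t⟧`)] [folklore] -/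
theorem isPadicInt_padicSigma_baseChange : IsPadicInt (W.baseChange ℚ_[p]).padicSigma :=
  isPadicInt_iff_coeff.mpr (W.baseChange ℚ_[p]).norm_coeff_padicSigma_le

variable {W p}

/-- **The theta relation at points from the formal theta identity of `σ_p` itself.** For a
`ℤ`-integral elliptic `W/ℚ`, ANY prime `p`, and rational points `P = (x₁, y₁)`, `Q = (x₂, y₂)` of
the kernel of reduction `E₁(ℚ_p)` with `x₁ ≠ x₂`: if the sigma series `σ = σ_p` of `W ⊗ ℚ_p`
satisfies `σ(F(u,v)) σ(F(u,i(v))) u²v² = (u²X(v) - v²X(u)) σ(u)² σ(v)²` in `ℚ_p⟦u, v⟧`, then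
`σ(P+Q) σ(P-Q) = (x(Q) - x(P)) σ(P)² σ(Q)²`. Proof: evaluate at `(u, v) = (z(P), z(Q))`
(`padicEval₂_thetaLHS/RHS`), read `F̂(u,v) = z(P+Q)`, `F̂(u, î(v)) = z(P-Q)`
(`formalGroupLaw_padicEval_holds`), `X̂(u) = x(P)u²`, cancel `u²v² ≠ 0`.
[Mazur–Tate 1991, Thm. 3.1; Blakestad–Grant 2023, Prop. 14 and Thm. 15] [folklore] -/
theorem padicSigmaAt_theta_of_thetaLHS_eq [W.IsElliptic] [W.IsIntegral ℤ]
    (hΘ : (W.baseChange ℚ_[p]).thetaLHS (W.baseChange ℚ_[p]).padicSigma =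
      (W.baseChange ℚ_[p]).thetaRHS (W.baseChange ℚ_[p]).padicSigma)
    {x₁ y₁ x₂ y₂ : ℚ} (h₁ : W.toAffine.Nonsingular x₁ y₁) (h₂ : W.toAffine.Nonsingular x₂ y₂)
    (hx₁ : 1 < ‖(x₁ : ℚ_[p])‖) (hx₂ : 1 < ‖(x₂ : ℚ_[p])‖) :
    W.padicSigmaAt p (.some x₁ y₁ h₁ + .some x₂ y₂ h₂) *
        W.padicSigmaAt p (.some x₁ y₁ h₁ - .some x₂ y₂ h₂) =
      ((x₂ : ℚ_[p]) - x₁) * W.padicSigmaAt p (.some x₁ y₁ h₁) ^ 2 *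
        W.padicSigmaAt p (.some x₂ y₂ h₂) ^ 2 := by
  set V := W.baseChange ℚ_[p] with hVdef
  have hσint : IsPadicInt V.padicSigma := W.isPadicInt_padicSigma_baseChange p
  have hFadd := formalGroupLaw_padicEval_holds p V
  -- the points over `ℚ_p`
  set ι := W.toPadicPoint p with hιdef
  set P : W.toAffine.Point := .some x₁ y₁ h₁ with hPdef
  set Q : W.toAffine.Point := .some x₂ y₂ h₂ with hQdef
  have hιP : ι P = .some (x₁ : ℚ_[p]) (y₁ : ℚ_[p]) (nonsingular_ratCast h₁) := toPadicPoint_some h₁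
  have hιQ : ι Q = .some (x₂ : ℚ_[p]) (y₂ : ℚ_[p]) (nonsingular_ratCast h₂) := toPadicPoint_some h₂
  have hιnQ : ι (-Q) = .some (x₂ : ℚ_[p]) (V.toAffine.negY (x₂ : ℚ_[p]) (y₂ : ℚ_[p]))
      ((Affine.nonsingular_neg ..).mpr (nonsingular_ratCast h₂)) := by
    rw [map_neg, hιQ, Affine.Point.neg_some]
  have hkP : V.IsInReductionKernel (ι P) := by rw [hιP]; exact hx₁
  have hkQ : V.IsInReductionKernel (ι Q) := by rw [hιQ]; exact hx₂
  have hknQ : V.IsInReductionKernel (ι (-Q)) := by rw [hιnQ]; exact hx₂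
  -- parameters
  obtain ⟨hy₁, hu0, hu1, -, -⟩ := V.param_facts (nonsingular_ratCast (p := p) h₁).1 hx₁
  obtain ⟨hy₂, hv0, hv1, -, -⟩ := V.param_facts (nonsingular_ratCast (p := p) h₂).1 hx₂
  set u : ℚ_[p] := -(x₁ : ℚ_[p]) / y₁ with hudef
  set v : ℚ_[p] := -(x₂ : ℚ_[p]) / y₂ with hvdef
  have hzP : V.formalParameter (ι P) = u := by rw [hιP]; rfl
  have hzQ : V.formalParameter (ι Q) = v := by rw [hιQ]; rfl
  have hznQ : V.formalParameter (ι (-Q)) = padicEval V.formalNeg v := by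
    rw [hιnQ, V.padicEval_formalNeg_eq (nonsingular_ratCast (p := p) h₂).1 hx₂]; rfl
  -- θ₃ at `(P, Q)` and `(P, -Q)`
  have hadd : padicEval₂ V.formalGroupLaw u v = W.padicParam p (P + Q) := by
    rw [← hzP, ← hzQ, hFadd _ _ hkP hkQ, ← map_add, formalParameter_toPadicPoint]
  have hsub : padicEval₂ V.formalGroupLaw u (padicEval V.formalNeg v) = W.padicParam p (P - Q) := by
    rw [← hzP, ← hznQ, hFadd _ _ hkP hknQ, ← map_add, ← sub_eq_add_neg, formalParameter_toPadicPoint]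
  -- the dictionary for `X = z²x`
  have hXu : padicEval V.formalXMulSq u = (x₁ : ℚ_[p]) * u ^ 2 :=
    V.padicEval_formalXMulSq_eq (nonsingular_ratCast (p := p) h₁).1 hx₁
  have hXv : padicEval V.formalXMulSq v = (x₂ : ℚ_[p]) * v ^ 2 :=
    V.padicEval_formalXMulSq_eq (nonsingular_ratCast (p := p) h₂).1 hx₂
  -- evaluate the formal identity at `(u, v)`
  have key := congrArg (fun G => padicEval₂ G u v) hΘ
  rw [padicEval₂_thetaLHS hσint hu1 hv1, padicEval₂_thetaRHS hσint hu1 hv1, hadd, hsub, hXu,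
    hXv] at key
  -- read the sigma values and cancel `u² v²`
  simp only [padicSigmaAt_eq_padicEval]
  rw [show W.padicParam p P = u from rfl, show W.padicParam p Q = v from rfl]
  have huv : u ^ 2 * v ^ 2 ≠ 0 := mul_ne_zero (pow_ne_zero 2 hu0) (pow_ne_zero 2 hv0)
  apply mul_right_cancel₀ huv
  linear_combination key

/-! ### The parallelogram law of the sigma formula, for one curve and one odd prime -/

/-- **The parallelogram law of the sigma formula on generic admissible pairs, pointwise.** For a
globally minimal elliptic `W/ℚ` and an ODD prime `p` whose sigma series satisfies the formal
theta identity, and `P, Q ∈ E(ℚ)` satisfying the local conditions with `P ≠ ±Q`: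
`ĥ(P+Q) + ĥ(P-Q) = 2ĥ(P) + 2ĥ(Q)`. Computation as in
`canonicalPAdicHeight_parallelogram_of_theta`: `d₃d₄ = d₁²d₂²δ²` (Néron's denominator law,
`den_mul_den_eq` + `padicValNat_den_parallelogram_holds`), `σ₃σ₄ = -δσ₁²σ₂²`
(`padicSigmaAt_theta_of_thetaLHS_eq`), `log_p(-1) = 0`. [Mazur–Stein–Tate 2006, §2.6–2.7;
Stein–Wuthrich 2013, §4.1 eq. (4.1)] [cite: MazurSteinTate2006, §2.7] -/
theorem canonicalPAdicHeight_parallelogram_of_thetaLHS_eq [W.IsElliptic] [W.IsGloballyMinimal]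
    (hp2 : p ≠ 2)
    (hΘ : (W.baseChange ℚ_[p]).thetaLHS (W.baseChange ℚ_[p]).padicSigma =
      (W.baseChange ℚ_[p]).thetaRHS (W.baseChange ℚ_[p]).padicSigma)
    (P Q : W.toAffine.Point) (hP : W.SatisfiesLocalConditions p P)
    (hQ : W.SatisfiesLocalConditions p Q) (hsub : P - Q ≠ 0) (hadd : P + Q ≠ 0) :
    W.canonicalPAdicHeight p (P + Q) + W.canonicalPAdicHeight p (P - Q) =
      2 * W.canonicalPAdicHeight p P + 2 * W.canonicalPAdicHeight p Q := by
  have hmul : padicLog_mul p := padicLog_mul_holds p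
  have hden : padicValNat_den_parallelogram := padicValNat_den_parallelogram_holds
  -- the subgroup: `P ± Q` again satisfy the local conditions
  obtain ⟨H, hH⟩ := W.exists_addSubgroup_coe_eq_localConditionsLocus p hp2
  have hmem : ∀ R, R ∈ H ↔ R = 0 ∨ W.SatisfiesLocalConditions p R := fun R => by
    rw [← SetLike.mem_coe, hH]; rfl
  have hPH : P ∈ H := (hmem P).mpr (Or.inr hP)
  have hQH : Q ∈ H := (hmem Q).mpr (Or.inr hQ)
  have hS' : W.SatisfiesLocalConditions p (P + Q) :=
    ((hmem _).mp (H.add_mem hPH hQH)).resolve_left hadd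
  have hD' : W.SatisfiesLocalConditions p (P - Q) :=
    ((hmem _).mp (H.sub_mem hPH hQH)).resolve_left hsub
  -- coordinates of the four points
  rcases P with _ | ⟨x₁, y₁, h₁⟩
  · exact (W.not_satisfiesLocalConditions_zero p hP).elim
  rcases Q with _ | ⟨x₂, y₂, h₂⟩
  · exact (W.not_satisfiesLocalConditions_zero p hQ).elim
  have hx : x₁ ≠ x₂ := X_ne_of_sub_ne_zero_of_add_ne_zero h₁ h₂ hsub hadd
  rcases hS : (.some x₁ y₁ h₁ : W.toAffine.Point) + .some x₂ y₂ h₂ with _ | ⟨x₃, y₃, h₃⟩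
  · exact (hadd hS).elim
  rcases hD : (.some x₁ y₁ h₁ : W.toAffine.Point) - .some x₂ y₂ h₂ with _ | ⟨x₄, y₄, h₄⟩
  · exact (hsub hD).elim
  rw [hS] at hS'
  rw [hD] at hD'
  obtain ⟨hx₁, -, hns₁⟩ := hP
  obtain ⟨hx₂, -, hns₂⟩ := hQ
  obtain ⟨hx₃, -, hns₃⟩ := hS'
  obtain ⟨hx₄, -, hns₄⟩ := hD'
  -- the theta relation and the denominator identity
  have hθ' := padicSigmaAt_theta_of_thetaLHS_eq hΘ h₁ h₂ hx₁ hx₂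
  rw [hS, hD] at hθ'
  have hden' := den_mul_den_eq hden W h₁ h₂ h₃ h₄ hx hS hD
    fun ℓ hℓ => ⟨hns₁ ℓ hℓ, hns₂ ℓ hℓ, hns₃ ℓ hℓ, hns₄ ℓ hℓ⟩
  have hdenp : ((x₃.den : ℚ) : ℚ_[p]) * ((x₄.den : ℚ) : ℚ_[p]) =
      ((x₁.den : ℚ) : ℚ_[p]) ^ 2 * ((x₂.den : ℚ) : ℚ_[p]) ^ 2 * ((x₁ : ℚ_[p]) - x₂) ^ 2 := by
    have := congrArg (fun q : ℚ => (q : ℚ_[p])) hden'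
    push_cast at this ⊢
    exact this
  -- non-vanishing
  have hσ₁ := W.padicSigmaAt_ne_zero p hp2 h₁ hx₁
  have hσ₂ := W.padicSigmaAt_ne_zero p hp2 h₂ hx₂
  have hσ₃ := W.padicSigmaAt_ne_zero p hp2 h₃ hx₃
  have hσ₄ := W.padicSigmaAt_ne_zero p hp2 h₄ hx₄
  have hd : ∀ x : ℚ, ((x.den : ℚ) : ℚ_[p]) ≠ 0 := fun x => by exact_mod_cast x.den_nz
  have hδ : (x₁ : ℚ_[p]) - x₂ ≠ 0 := sub_ne_zero.mpr (by exact_mod_cast hx)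
  -- logarithms
  have hlogd : padicLog p ((x₃.den : ℚ) : ℚ_[p]) + padicLog p ((x₄.den : ℚ) : ℚ_[p]) =
      2 * padicLog p ((x₁.den : ℚ) : ℚ_[p]) + 2 * padicLog p ((x₂.den : ℚ) : ℚ_[p]) +
        2 * padicLog p ((x₁ : ℚ_[p]) - x₂) := by
    rw [← hmul (hd x₃) (hd x₄), hdenp, hmul (mul_ne_zero (pow_ne_zero 2 (hd x₁))
      (pow_ne_zero 2 (hd x₂))) (pow_ne_zero 2 hδ), hmul (pow_ne_zero 2 (hd x₁))
      (pow_ne_zero 2 (hd x₂)), padicLog_sq (hd x₁), padicLog_sq (hd x₂), padicLog_sq hδ]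
  have hlogσ : padicLog p (W.padicSigmaAt p (.some x₃ y₃ h₃)) +
      padicLog p (W.padicSigmaAt p (.some x₄ y₄ h₄)) =
        padicLog p ((x₁ : ℚ_[p]) - x₂) + 2 * padicLog p (W.padicSigmaAt p (.some x₁ y₁ h₁)) +
          2 * padicLog p (W.padicSigmaAt p (.some x₂ y₂ h₂)) := by
    have hδ' : (x₂ : ℚ_[p]) - x₁ ≠ 0 := by rw [← neg_sub]; exact neg_ne_zero.mpr hδ
    rw [← hmul hσ₃ hσ₄, hθ', hmul (mul_ne_zero hδ' (pow_ne_zero 2 hσ₁)) (pow_ne_zero 2 hσ₂),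
      hmul hδ' (pow_ne_zero 2 hσ₁), padicLog_sq hσ₁, padicLog_sq hσ₂, ← neg_sub, padicLog_neg hδ]
  rw [hS, hD]
  simp only [canonicalPAdicHeight_some]
  linear_combination hlogd - 2 * hlogσ

/-! ### The canonical datum for one curve and one odd prime -/

/-- **Existence of the canonical `p`-adic height datum, pointwise.** For a globally minimal
elliptic `W/ℚ` and an ODD prime `p` such that the sigma series `σ_p` of `W ⊗ ℚ_p` satisfies the
formal theta identity, there is a symmetric bilinear torsion-vanishing pairing
`E(ℚ) × E(ℚ) → ℚ_p` whose quadratic form on admissible points is the sigma formula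
`ĥ_p(P) = log_p(den x(P)) - 2 log_p σ_p(z(P))`: the parallelogram law on the torsion-free
admissible subgroup `E₁ ∩ ⋂ E₀` (`not_isOfFinAddOrder_of_one_lt_padicNorm_holds`,
`parallelogram_of_generic`) and Jordan–von Neumann on a subgroup
(`exists_pairing_of_parallelogram`). [Mazur–Stein–Tate 2006, §1 ("extends uniquely"), §2.6–2.7;
Stein–Wuthrich 2013, §4.1 eq. (4.1)] [cite: MazurSteinTate2006, §2.7] -/
theorem exists_isCanonical_of_thetaLHS_eq (W : WeierstrassCurve ℚ) [W.IsElliptic]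
    [W.IsGloballyMinimal] (p : ℕ) [Fact p.Prime] (hp2 : p ≠ 2)
    (hΘ : (W.baseChange ℚ_[p]).thetaLHS (W.baseChange ℚ_[p]).padicSigma =
      (W.baseChange ℚ_[p]).thetaRHS (W.baseChange ℚ_[p]).padicSigma) :
    ∃ D : PAdicHeightData W p, D.IsCanonical := by
  have hp3 : 3 ≤ p := by
    have h2 := (Fact.out : p.Prime).two_le
    omega
  obtain ⟨H, hH⟩ := W.exists_addSubgroup_coe_eq_localConditionsLocus p hp2
  have hmem : ∀ P, P ∈ H ↔ P = 0 ∨ W.SatisfiesLocalConditions p P := fun P => by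
    rw [← SetLike.mem_coe, hH]; rfl
  have hslc : ∀ P ∈ H, P ≠ 0 → W.SatisfiesLocalConditions p P := fun P hP h0 =>
    ((hmem P).mp hP).resolve_left h0
  -- `H` is torsion-free
  have htf' : ∀ P ∈ H, IsOfFinAddOrder P → P = 0 := by
    intro P hP hfin
    by_contra h0
    have hP' := hslc P hP h0
    cases P with
    | zero => exact h0 rfl
    | some x y h => exact not_isOfFinAddOrder_of_one_lt_padicNorm_holds W p hp3 h hP'.1 hfin
  -- the full parallelogram law on `H`
  have hfull := Literature.NumberTheory.EllipticCurves.parallelogram_of_generic H htf'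
    (W.canonicalPAdicHeight p) rfl fun P hP Q hQ hP0 hQ0 hPQ hPQ' =>
      canonicalPAdicHeight_parallelogram_of_thetaLHS_eq hp2 hΘ P Q (hslc P hP hP0) (hslc Q hQ hQ0)
        hPQ hPQ'
  obtain ⟨B, hsymm, htors, hdiag⟩ :=
    Literature.NumberTheory.EllipticCurves.exists_pairing_of_parallelogram H _ hfull
  exact ⟨⟨B, hsymm, fun P Q hP => htors P Q hP⟩, fun P hP => hdiag P ((hmem P).mpr (Or.inr hP.2))⟩

/-- **The canonical datum is unique, pointwise** (admissible multiples exist,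
`exists_admissible_nsmul_holds`; two canonical data coincide, `isCanonical_unique`).
[Mazur–Stein–Tate 2006, §1 ("extends uniquely … `h_p(nQ) = n² h_p(Q)`")] [folklore] -/
theorem existsUnique_isCanonical_of_thetaLHS_eq (W : WeierstrassCurve ℚ) [W.IsElliptic]
    [W.IsGloballyMinimal] (p : ℕ) [Fact p.Prime] (hp2 : p ≠ 2)
    (hΘ : (W.baseChange ℚ_[p]).thetaLHS (W.baseChange ℚ_[p]).padicSigma =
      (W.baseChange ℚ_[p]).thetaRHS (W.baseChange ℚ_[p]).padicSigma) :
    ∃! D : PAdicHeightData W p, D.IsCanonical := by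
  obtain ⟨D, hD⟩ := exists_isCanonical_of_thetaLHS_eq W p hp2 hΘ
  exact ⟨D, hD, fun D' hD' =>
    PAdicHeightData.isCanonical_unique (exists_admissible_nsmul_holds W p) hD' hD⟩

end Pointwise

/-! ### Global corollaries: what `exists_isCanonical` still rests on -/

/-- **`exists_isCanonical` from one formal identity per curve and prime**: if for every globally
minimal elliptic `W/ℚ` and every prime `p ≥ 5` of good ordinary reduction the sigma series of
`W ⊗ ℚ_p` satisfies the formal theta identity, the canonical datum exists.
[Mazur–Stein–Tate 2006, §2.7; Stein–Wuthrich 2013, §4.1 eq. (4.1)] [folklore] -/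
theorem exists_isCanonical_of_forall_thetaLHS_eq
    (h : ∀ (W : WeierstrassCurve ℚ) [W.IsElliptic] [W.IsGloballyMinimal] (p : ℕ) [Fact p.Prime],
      5 ≤ p → W.HasGoodReductionAtPrime p → ¬ (p : ℤ) ∣ W.frobeniusTrace p →
        (W.baseChange ℚ_[p]).thetaLHS (W.baseChange ℚ_[p]).padicSigma =
          (W.baseChange ℚ_[p]).thetaRHS (W.baseChange ℚ_[p]).padicSigma) :
    exists_isCanonical := by
  intro W _ _ p _ hp hgood hord
  exact exists_isCanonical_of_thetaLHS_eq W p (by omega) (h W p hp hgood hord)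

/-- **The theta relation at points from the EXISTENCE of a Mazur–Tate pair and θ₂** (the
uniqueness clause of MST 2006 Thm. 1.3 is not needed: any chosen pair is integral, odd,
normalised and solves the sigma differential equation, which is all θ₂ asks).
[Mazur–Tate 1991, Thm. 3.1; Mazur–Stein–Tate 2006, Thm. 1.3; Blakestad–Grant 2023, Prop. 14]
[folklore] -/
theorem padicSigma_theta_of_exists_pair
    (hex : ∀ (W : WeierstrassCurve ℚ) [W.IsElliptic] [W.IsGloballyMinimal] (p : ℕ) [Fact p.Prime],
      5 ≤ p → W.HasGoodReductionAtPrime p → ¬ (p : ℤ) ∣ W.frobeniusTrace p →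
        ∃ σ : ℚ_[p]⟦X⟧, ∃ c : ℚ_[p], (W.baseChange ℚ_[p]).IsMazurTateSigmaPair σ c)
    (hθ : padicSigma_theta_formal) : padicSigma_theta := by
  intro W _ _ p _ hp hgood hord x₁ y₁ x₂ y₂ h₁ h₂ hx₁ hx₂ _
  have hpair := (W.baseChange ℚ_[p]).isMazurTateSigmaPair_padicSigma (hex W p hp hgood hord)
  exact padicSigmaAt_theta_of_thetaLHS_eq (hθ W p hp hgood hord _ _ hpair) h₁ h₂ hx₁ hx₂

/-- **`exists_isCanonical` from the existence half of MST 2006 Thm. 1.3 and θ₂.**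
[Mazur–Stein–Tate 2006, Thm. 1.3, §2.7; Blakestad–Grant 2023, Prop. 14; Stein–Wuthrich 2013,
§4.1 eq. (4.1)] [folklore] -/
theorem exists_isCanonical_of_exists_pair
    (hex : ∀ (W : WeierstrassCurve ℚ) [W.IsElliptic] [W.IsGloballyMinimal] (p : ℕ) [Fact p.Prime],
      5 ≤ p → W.HasGoodReductionAtPrime p → ¬ (p : ℤ) ∣ W.frobeniusTrace p →
        ∃ σ : ℚ_[p]⟦X⟧, ∃ c : ℚ_[p], (W.baseChange ℚ_[p]).IsMazurTateSigmaPair σ c)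
    (hθ : padicSigma_theta_formal) : exists_isCanonical :=
  exists_isCanonical_of_forall_thetaLHS_eq fun W _ _ p _ hp hgood hord =>
    hθ W p hp hgood hord _ _
      ((W.baseChange ℚ_[p]).isMazurTateSigmaPair_padicSigma (hex W p hp hgood hord))

/-- The same with uniqueness of the datum (no hypothesis on admissible multiples: they exist,
`exists_admissible_nsmul_holds`). [Mazur–Stein–Tate 2006, §1] [folklore] -/
theorem existsUnique_isCanonical_of_exists_pair
    (hex : ∀ (W : WeierstrassCurve ℚ) [W.IsElliptic] [W.IsGloballyMinimal] (p : ℕ) [Fact p.Prime],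
      5 ≤ p → W.HasGoodReductionAtPrime p → ¬ (p : ℤ) ∣ W.frobeniusTrace p →
        ∃ σ : ℚ_[p]⟦X⟧, ∃ c : ℚ_[p], (W.baseChange ℚ_[p]).IsMazurTateSigmaPair σ c)
    (hθ : padicSigma_theta_formal) (W : WeierstrassCurve ℚ) [W.IsElliptic] [W.IsGloballyMinimal]
    (p : ℕ) [Fact p.Prime] (hp : 5 ≤ p) (hgood : W.HasGoodReductionAtPrime p)
    (hord : ¬ (p : ℤ) ∣ W.frobeniusTrace p) : ∃! D : PAdicHeightData W p, D.IsCanonical :=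
  existsUnique_isCanonical_of_thetaLHS_eq W p (by omega)
    (hθ W p hp hgood hord _ _
      ((W.baseChange ℚ_[p]).isMazurTateSigmaPair_padicSigma (hex W p hp hgood hord)))

/-- In particular the tree's `∃!` form loses its hypothesis `exists_admissible_nsmul`
(cf. `existsUnique_isCanonical_of_MT_theta`). [Mazur–Stein–Tate 2006, §1] [folklore] -/
theorem existsUnique_isCanonical_of_MT_theta' (hMT : mazur_tate_sigma_existsUnique)
    (hθ : padicSigma_theta_formal) (W : WeierstrassCurve ℚ) [W.IsElliptic] [W.IsGloballyMinimal]
    (p : ℕ) [Fact p.Prime] (hp : 5 ≤ p) (hgood : W.HasGoodReductionAtPrime p)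
    (hord : ¬ (p : ℤ) ∣ W.frobeniusTrace p) : ∃! D : PAdicHeightData W p, D.IsCanonical :=
  existsUnique_isCanonical_of_exists_pair
    (fun W _ _ p _ hp hgood hord =>
      let ⟨σc, hσc, _⟩ := hMT W p hp hgood hord
      ⟨σc.1, σc.2, hσc⟩)
    hθ W p hp hgood hord

end WeierstrassCurve
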